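import Literature.Geometry.Symplectic.GirouxContactPathAlgebra
import Literature.Geometry.Kaehler.ManifoldFormsFunSmulProofs
import Literature.Geometry.Kaehler.ManifoldFormsPullback
import HarnessLib

/-!
# Giroux's path of contact forms, II: flat forms on `ℝ³` and the model form `f(r) dθ`

Topic `Literature/Geometry/Symplectic`.  Second file of the proof of
`Literature.Geometry.Symplectic.GirouxContactPath` (Etnyre 2006, Prop. 3.5/3.18 and the proof of
Lemma 3.3).  All sign computations of the printed proof are carried out on flat local models
(`ℝ³` with coordinates `p = (p₀, p₁, p₂) = (ψ, x, y)`, the binding being `{x = y = 0}` and the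
pages `{θ = const}`, `(x, y) = r e^{iθ}`); this file provides the flat calculus:

* `toMForm f` regards a field of alternating maps `f : V → V [⋀^Fin k]→L[ℝ] F` on a normed
  space as a form for the trivial model `𝓘(ℝ, V)`; its chart representative is `f`
  (`inChart_toMForm`), smoothness is `ContDiff` (`smoothAt_toMForm_iff`,
  `isSmoothForm_toMForm_iff`) and `d` is Mathlib's `extDeriv` (`mextDeriv_toMForm_apply`);
  all bridges are stated as equalities of SCALARS, so that no rewriting ever has to see through
  the definitional identification `TangentSpace 𝓘(ℝ, V) x = V`;
* the two-vector formulas for `extDeriv` of a `1`-form (`extDeriv_apply_two`) and for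
  `wedgeOne` (`wedgeOne_apply_two`), and the flat Leibniz rule `extDeriv_fun_smul`;
* the model forms on `ℝ³`: `lamF = x dy - y dx = r² dθ` (`extDeriv_lamF_apply`:
  `d lam = 2 dx ∧ dy`), `rho = x² + y² = r²` (`fderiv_rho_apply`), and Etnyre's
  `f(r) dθ = κ(r²) · r² dθ`, here `bflatF κ = (κ ∘ rho) • lamF` (`extDeriv_bflatF_apply`:
  `d(κ(ρ) lam) = κ(ρ) d lam + κ'(ρ) dρ ∧ lam`), with their `MForm` versions `lam`, `bflat κ`;
* the angle form of the plane as a form `Λ₂` on `ℝ²` (`Λ₂_apply`), and the projection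
  `πw : ℝ³ → ℝ²`, `p ↦ (x, y)` (`norm_πw_sq : ‖πw p‖² = rho p`,
  `angleForm_πw : dφ_{πw p}(πw v) = lam p (v)`), used later for the tube parametrisation
  `p ↦ tube (e^{iψ}, (x, y))`.

Everything is proved; the only definitions are the explicit model objects just listed.

## References

* J. B. Etnyre, *Lectures on open book decompositions and contact structures* (2006), proof of
  Lemma 3.3 (`α_R = α + R f(r) dθ`, `f(r) = r²` near the binding). [Etnyre2006]
-/

noncomputable section

open scoped Manifold ContDiff Topology
open Set Function
open Literature.Geometry.Kaehler

namespace Literature.Geometry.Symplectic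

/-- Local notation: `𝔼 n` is the model Euclidean space `EuclideanSpace ℝ (Fin n)`. -/
local notation "𝔼 " n:arg => EuclideanSpace ℝ (Fin n)

/-! ### Forms on a normed space are functions -/

section FlatGeneral

variable {V : Type*} [NormedAddCommGroup V] [NormedSpace ℝ V]
  {F : Type*} [NormedAddCommGroup F] [NormedSpace ℝ F] {k : ℕ}

/-- A field of alternating `k`-linear maps on a normed space `V`, regarded as a `k`-form on the
manifold `V` (trivial model `𝓘(ℝ, V)`, `T_xV = V`). [folklore] -/
def toMForm (f : V → V [⋀^Fin k]→L[ℝ] F) : MForm 𝓘(ℝ, V) V F k := fun x => (f x :)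

/-- Values of `toMForm f` are those of `f`. [folklore] -/
@[simp] theorem toMForm_apply (f : V → V [⋀^Fin k]→L[ℝ] F) (x : V) (v : Fin k → V) :
    toMForm f x v = f x v := rfl

/-- On a normed space the chart representative of `toMForm f` is `f` itself. [folklore] -/
theorem inChart_toMForm (f : V → V [⋀^Fin k]→L[ℝ] F) (x : V) : (toMForm f).inChart x = f := by
  funext y
  ext v
  simp [MForm.inChart_apply]
  rfl

/-- On a normed space, smoothness of `toMForm f` at a point is `ContDiffAt` of `f`. [folklore] -/
theorem smoothAt_toMForm_iff (f : V → V [⋀^Fin k]→L[ℝ] F) (x : V) :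
    (toMForm f).SmoothAt x ↔ ContDiffAt ℝ ∞ f x := by
  rw [MForm.SmoothAt, inChart_toMForm]
  simp only [modelWithCornersSelf_coe, range_id, extChartAt_model_space_eq_id,
    PartialEquiv.refl_coe, id_eq, contDiffWithinAt_univ]

/-- On a normed space, smoothness of `toMForm f` is `ContDiff` of `f`. [folklore] -/
theorem isSmoothForm_toMForm_iff (f : V → V [⋀^Fin k]→L[ℝ] F) :
    IsSmoothForm (toMForm f) ↔ ContDiff ℝ ∞ f := by
  rw [isSmoothForm_iff_smoothAt, contDiff_iff_contDiffAt]
  exact forall_congr' fun x => smoothAt_toMForm_iff f x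

/-- **On a normed space `d` is `extDeriv`**, as an equality of values. [folklore] -/
theorem mextDeriv_toMForm_apply (f : V → V [⋀^Fin k]→L[ℝ] F) (x : V) (v : Fin (k + 1) → V) :
    mextDeriv (toMForm f) x v = extDeriv f x v := by
  rw [mextDeriv_eq_extDeriv]
  rfl

/-- A form on `V` that agrees with `toMForm f` near `x` has `d` equal to `extDeriv f` at `x`
(locality of `d`). [folklore] -/
theorem mextDeriv_apply_of_eventuallyEq_toMForm {α : MForm 𝓘(ℝ, V) V F k}
    {f : V → V [⋀^Fin k]→L[ℝ] F} {x : V} (h : ∀ᶠ y in 𝓝 x, α y = toMForm f y)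
    (v : Fin (k + 1) → V) : mextDeriv α x v = extDeriv f x v := by
  rw [mextDeriv_congr_of_eventuallyEq h, mextDeriv_toMForm_apply]

/-- **`extDeriv` of a `1`-form on two vectors**:
`dω(u, v) = D_u(ω(·)(v)) - D_v(ω(·)(u))` (Mathlib's normalisation, `extDeriv_apply`). [folklore] -/
theorem extDeriv_apply_two {α : V → V [⋀^Fin 1]→L[ℝ] F} {x : V} (h : DifferentiableAt ℝ α x)
    (u v : V) :
    extDeriv α x ![u, v] =
      fderiv ℝ (fun y => α y ![v]) x u - fderiv ℝ (fun y => α y ![u]) x v := by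
  have h0 : Fin.removeNth (0 : Fin 2) (![u, v] : Fin 2 → V) = ![v] := by
    funext i; fin_cases i; rfl
  have h1 : Fin.removeNth (1 : Fin 2) (![u, v] : Fin 2 → V) = ![u] := by
    funext i; fin_cases i; rfl
  rw [extDeriv_apply h, Fin.sum_univ_two, h0, h1]
  simp [pow_succ, sub_eq_add_neg]

/-- **`wedgeOne` on two vectors**: `(θ ∧ η)(u, v) = θ(u) η(v) - θ(v) η(u)` for a `1`-form `η`.
[folklore] -/
theorem wedgeOne_apply_two (θ : V →L[ℝ] ℝ) (η : V [⋀^Fin 1]→L[ℝ] F) (u v : V) :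
    Literature.LinearAlgebra.Alternating.wedgeOne θ η ![u, v] = θ u • η ![v] - θ v • η ![u] := by
  have h0 : Fin.removeNth (0 : Fin 2) (![u, v] : Fin 2 → V) = ![v] := by
    funext i; fin_cases i; rfl
  have h1 : Fin.removeNth (1 : Fin 2) (![u, v] : Fin 2 → V) = ![u] := by
    funext i; fin_cases i; rfl
  rw [Literature.LinearAlgebra.Alternating.wedgeOne_apply, Fin.sum_univ_two, h0, h1]
  simp [pow_succ, sub_eq_add_neg]

/-- **Flat Leibniz rule** `d(g ω) = g dω + dg ∧ ω` at a point (from the tree's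
`extDerivWithin_fun_smul'` within `univ`). [folklore] -/
theorem extDeriv_fun_smul {g : V → ℝ} {β : V → V [⋀^Fin k]→L[ℝ] F} {x : V}
    (hg : DifferentiableAt ℝ g x) (hβ : DifferentiableAt ℝ β x) :
    extDeriv (fun y => g y • β y) x =
      g x • extDeriv β x + Literature.LinearAlgebra.Alternating.wedgeOne (fderiv ℝ g x) (β x) := by
  have h := extDerivWithin_fun_smul' (s := univ) hg.differentiableWithinAt hβ.differentiableWithinAt
    uniqueDiffWithinAt_univ
  simpa only [extDerivWithin_univ, fderivWithin_univ] using h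

/-- The `1`-form field of a `C^∞` covector field is `C^∞` (`ofSubsingleton` is a linear
isometry). [folklore] -/
theorem contDiff_ofSubsingleton_comp {f : V → V →L[ℝ] ℝ} (hf : ContDiff ℝ ∞ f) :
    ContDiff ℝ ∞ fun x => ContinuousAlternatingMap.ofSubsingleton ℝ V ℝ (0 : Fin 1) (f x) :=
  (ContinuousAlternatingMap.ofSubsingletonLIE (𝕜 := ℝ) (E := V) (F := ℝ)
    (0 : Fin 1)).toContinuousLinearEquiv.contDiff.comp hf

end FlatGeneral

/-! ### The model forms on `ℝ³`: `lam = x dy - y dx`, `rho = x² + y²`, `bflat κ = κ(rho) lam` -/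

section Model

/-- The covector `x dy - y dx` at `p = (ψ, x, y) ∈ ℝ³` (`x = p 1`, `y = p 2`). [folklore] -/
def lamCov (p : 𝔼 3) : (𝔼 3) →L[ℝ] ℝ :=
  p 1 • EuclideanSpace.proj (2 : Fin 3) - p 2 • EuclideanSpace.proj (1 : Fin 3)

/-- `lamCov p v = x v_y - y v_x`. [folklore] -/
@[simp] theorem lamCov_apply (p v : 𝔼 3) : lamCov p v = p 1 * v 2 - p 2 * v 1 := by
  simp [lamCov]

/-- `lamCov` is `C^∞` (it is linear in `p`). [folklore] -/
theorem contDiff_lamCov : ContDiff ℝ ∞ lamCov := by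
  unfold lamCov
  fun_prop

/-- **The model `1`-form `lam = x dy - y dx = r² dθ` on `ℝ³`**, as a field of alternating maps
(Etnyre's `f(r) dθ` with `f = r²`, the form that is smooth across the binding `{x = y = 0}`).
[cite: Etnyre2006, proof of Lemma 3.3] -/
def lamF (p : 𝔼 3) : (𝔼 3) [⋀^Fin 1]→L[ℝ] ℝ :=
  ContinuousAlternatingMap.ofSubsingleton ℝ (𝔼 3) ℝ (0 : Fin 1) (lamCov p)

/-- `lamF p (v) = x v_y - y v_x`. [folklore] -/
@[simp] theorem lamF_apply (p : 𝔼 3) (v : Fin 1 → 𝔼 3) :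
    lamF p v = p 1 * (v 0) 2 - p 2 * (v 0) 1 := by
  simp [lamF]

/-- `lamF` is `C^∞`. [folklore] -/
theorem contDiff_lamF : ContDiff ℝ ∞ lamF :=
  contDiff_ofSubsingleton_comp contDiff_lamCov

/-- The scalar component `y ↦ lamF y (v)` has derivative `u ↦ u_x v_y - u_y v_x`. [folklore] -/
theorem hasFDerivAt_lamF_apply (p v : 𝔼 3) :
    HasFDerivAt (fun y : 𝔼 3 => lamF y ![v])
      ((v 2) • EuclideanSpace.proj (𝕜 := ℝ) (1 : Fin 3) -
        (v 1) • EuclideanSpace.proj (𝕜 := ℝ) (2 : Fin 3)) p := by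
  have h : (fun y : 𝔼 3 => lamF y ![v]) = fun y => v 2 * y 1 - v 1 * y 2 := by
    funext y; simp [lamF_apply]; ring
  rw [h]
  apply HasFDerivAt.sub
  · have := ((EuclideanSpace.proj (1 : Fin 3) : (𝔼 3) →L[ℝ] ℝ).hasFDerivAt (x := p)).const_mul (v 2)
    simpa using this
  · have := ((EuclideanSpace.proj (2 : Fin 3) : (𝔼 3) →L[ℝ] ℝ).hasFDerivAt (x := p)).const_mul (v 1)
    simpa using this

/-- **`d lam = 2 dx ∧ dy`**: `(d lam)_p (u, v) = 2 (u_x v_y - u_y v_x)`. [folklore] -/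
theorem extDeriv_lamF_apply (p u v : 𝔼 3) :
    extDeriv lamF p ![u, v] = 2 * (u 1 * v 2 - u 2 * v 1) := by
  rw [extDeriv_apply_two (contDiff_lamF.contDiffAt.differentiableAt (by simp)),
    (hasFDerivAt_lamF_apply p v).fderiv, (hasFDerivAt_lamF_apply p u).fderiv]
  simp
  ring

/-- **`rho = x² + y² = r²`** on `ℝ³`. [folklore] -/
def rho (p : 𝔼 3) : ℝ := p 1 ^ 2 + p 2 ^ 2

/-- `rho` is nonnegative. [folklore] -/
theorem rho_nonneg (p : 𝔼 3) : 0 ≤ rho p := by unfold rho; positivity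

/-- `rho p = 0` iff `x = y = 0`. [folklore] -/
theorem rho_eq_zero_iff (p : 𝔼 3) : rho p = 0 ↔ p 1 = 0 ∧ p 2 = 0 := by
  unfold rho
  constructor
  · intro h
    have h1 : p 1 ^ 2 = 0 := by nlinarith [sq_nonneg (p 1), sq_nonneg (p 2)]
    have h2 : p 2 ^ 2 = 0 := by nlinarith [sq_nonneg (p 1), sq_nonneg (p 2)]
    exact ⟨by simpa using h1, by simpa using h2⟩
  · rintro ⟨h1, h2⟩; simp [h1, h2]

/-- `rho` is `C^∞`. [folklore] -/
theorem contDiff_rho : ContDiff ℝ ∞ rho := by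
  unfold rho
  fun_prop

/-- The derivative of `rho`: `D rho(p) u = 2 (x u_x + y u_y)`. [folklore] -/
theorem hasFDerivAt_rho (p : 𝔼 3) :
    HasFDerivAt rho ((2 * p 1) • EuclideanSpace.proj (𝕜 := ℝ) (1 : Fin 3) +
      (2 * p 2) • EuclideanSpace.proj (𝕜 := ℝ) (2 : Fin 3)) p := by
  unfold rho
  apply HasFDerivAt.add
  · have h := ((EuclideanSpace.proj (1 : Fin 3) : (𝔼 3) →L[ℝ] ℝ).hasFDerivAt (x := p)).pow 2
    simpa using h
  · have h := ((EuclideanSpace.proj (2 : Fin 3) : (𝔼 3) →L[ℝ] ℝ).hasFDerivAt (x := p)).pow 2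
    simpa using h

/-- `D rho(p) u = 2 (x u_x + y u_y)`. [folklore] -/
theorem fderiv_rho_apply (p u : 𝔼 3) : fderiv ℝ rho p u = 2 * (p 1 * u 1 + p 2 * u 2) := by
  rw [(hasFDerivAt_rho p).fderiv]
  simp
  ring

/-- **Etnyre's `f(r) dθ`** as a field of alternating maps: `bflatF κ = κ(r²) · (x dy - y dx)
= κ(r²) r² dθ` on `ℝ³` (`κ = 1` near `0` gives `r² dθ` near the binding, `κ(ρ) = c/ρ` far away
gives `c dθ`). [cite: Etnyre2006, proof of Lemma 3.3] -/
def bflatF (κ : ℝ → ℝ) (p : 𝔼 3) : (𝔼 3) [⋀^Fin 1]→L[ℝ] ℝ := κ (rho p) • lamF p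

/-- `bflatF κ p (v) = κ(rho p) (x v_y - y v_x)`. [folklore] -/
@[simp] theorem bflatF_apply (κ : ℝ → ℝ) (p : 𝔼 3) (v : Fin 1 → 𝔼 3) :
    bflatF κ p v = κ (rho p) * (p 1 * (v 0) 2 - p 2 * (v 0) 1) := by
  simp [bflatF]

/-- `bflatF κ` is `C^∞` for `C^∞` `κ`. [folklore] -/
theorem contDiff_bflatF {κ : ℝ → ℝ} (hκ : ContDiff ℝ ∞ κ) : ContDiff ℝ ∞ (bflatF κ) :=
  (hκ.comp contDiff_rho).smul contDiff_lamF

/-- **`d(κ(ρ) lam) = κ(ρ) d lam + κ'(ρ) dρ ∧ lam`** on two vectors. [cite: Etnyre2006, proof of Lemma 3.3] -/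
theorem extDeriv_bflatF_apply {κ : ℝ → ℝ} (hκ : ContDiff ℝ ∞ κ) (p u v : 𝔼 3) :
    extDeriv (bflatF κ) p ![u, v] =
      κ (rho p) * (2 * (u 1 * v 2 - u 2 * v 1)) +
        deriv κ (rho p) *
          (2 * (p 1 * u 1 + p 2 * u 2) * (p 1 * v 2 - p 2 * v 1) -
            2 * (p 1 * v 1 + p 2 * v 2) * (p 1 * u 2 - p 2 * u 1)) := by
  have hκd : DifferentiableAt ℝ κ (rho p) := hκ.contDiffAt.differentiableAt (by simp)
  have hρd : DifferentiableAt ℝ rho p := contDiff_rho.contDiffAt.differentiableAt (by simp)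
  have hg : DifferentiableAt ℝ (fun y => κ (rho y)) p := hκd.comp p hρd
  have hβ : DifferentiableAt ℝ lamF p := contDiff_lamF.contDiffAt.differentiableAt (by simp)
  have hD : fderiv ℝ (fun y => κ (rho y)) p = deriv κ (rho p) • fderiv ℝ rho p := by
    have h := (hκd.hasDerivAt.comp_hasFDerivAt p hρd.hasFDerivAt).fderiv
    rw [show (κ ∘ rho) = fun y => κ (rho y) from rfl] at h
    rw [h]
  have hb : bflatF κ = fun y => κ (rho y) • lamF y := rfl
  rw [hb, extDeriv_fun_smul hg hβ]
  simp only [ContinuousAlternatingMap.add_apply, ContinuousAlternatingMap.smul_apply,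
    extDeriv_lamF_apply, wedgeOne_apply_two, hD, _root_.smul_apply,
    fderiv_rho_apply, lamF_apply, smul_eq_mul, Matrix.cons_val_zero]
  ring

/-- The model form `lam = x dy - y dx` as a `1`-form on the manifold `ℝ³`. [folklore] -/
def lam : MForm (𝓡 3) (𝔼 3) ℝ 1 := toMForm lamF

/-- `lam p (v) = x v_y - y v_x`. [folklore] -/
@[simp] theorem lam_apply (p : 𝔼 3) (v : Fin 1 → 𝔼 3) :
    lam p v = p 1 * (v 0) 2 - p 2 * (v 0) 1 := by
  rw [lam, toMForm_apply, lamF_apply]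

/-- `lam` is a smooth form. [folklore] -/
theorem isSmoothForm_lam : IsSmoothForm lam :=
  (isSmoothForm_toMForm_iff _).2 contDiff_lamF

/-- `d lam (u, v) = 2 (u_x v_y - u_y v_x)` in manifold notation. [folklore] -/
theorem mextDeriv_lam_apply (p u v : 𝔼 3) :
    mextDeriv lam p ![u, v] = 2 * (u 1 * v 2 - u 2 * v 1) := by
  rw [lam, mextDeriv_toMForm_apply]
  exact extDeriv_lamF_apply p u v

/-- Etnyre's `f(r) dθ = κ(r²) r² dθ` as a `1`-form `bflat κ` on the manifold `ℝ³`.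
[cite: Etnyre2006, proof of Lemma 3.3] -/
def bflat (κ : ℝ → ℝ) : MForm (𝓡 3) (𝔼 3) ℝ 1 := toMForm (bflatF κ)

/-- `bflat κ p (v) = κ(rho p) (x v_y - y v_x)`. [folklore] -/
@[simp] theorem bflat_apply (κ : ℝ → ℝ) (p : 𝔼 3) (v : Fin 1 → 𝔼 3) :
    bflat κ p v = κ (rho p) * (p 1 * (v 0) 2 - p 2 * (v 0) 1) := by
  rw [bflat, toMForm_apply, bflatF_apply]

/-- `bflat κ = (κ ∘ rho) • lam` as forms (function times form). [folklore] -/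
theorem bflat_eq_smul (κ : ℝ → ℝ) : bflat κ = (κ ∘ rho) • lam := rfl

/-- `bflat κ` is a smooth form for `C^∞` `κ`. [folklore] -/
theorem isSmoothForm_bflat {κ : ℝ → ℝ} (hκ : ContDiff ℝ ∞ κ) : IsSmoothForm (bflat κ) :=
  (isSmoothForm_toMForm_iff _).2 (contDiff_bflatF hκ)

/-- `d(bflat κ)(u, v)` in manifold notation: `κ(ρ) d lam (u, v) + κ'(ρ) (dρ ∧ lam)(u, v)`.
[cite: Etnyre2006, proof of Lemma 3.3] -/
theorem mextDeriv_bflat_apply {κ : ℝ → ℝ} (hκ : ContDiff ℝ ∞ κ) (p u v : 𝔼 3) :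
    mextDeriv (bflat κ) p ![u, v] =
      κ (rho p) * (2 * (u 1 * v 2 - u 2 * v 1)) +
        deriv κ (rho p) *
          (2 * (p 1 * u 1 + p 2 * u 2) * (p 1 * v 2 - p 2 * v 1) -
            2 * (p 1 * v 1 + p 2 * v 2) * (p 1 * u 2 - p 2 * u 1)) := by
  rw [bflat, mextDeriv_toMForm_apply]
  exact extDeriv_bflatF_apply hκ p u v

/-! ### The plane: the angle form `Λ₂` and the projection `πw : ℝ³ → ℝ²` -/

/-- **The angle form `x dy - y dx` of the plane as a `1`-form `Λ₂` on the manifold `ℝ²`**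
(values `angleForm`, `PlanarContactBoundary.lean`). [folklore] -/
def Λ₂ : MForm (𝓡 2) (𝔼 2) ℝ 1 :=
  toMForm fun w => ContinuousAlternatingMap.ofSubsingleton ℝ (𝔼 2) ℝ (0 : Fin 1) (angleForm w)

/-- `Λ₂ w (v) = dφ_w (v 0) = w₀ (v 0)₁ - w₁ (v 0)₀`. [folklore] -/
@[simp] theorem Λ₂_apply (w : 𝔼 2) (v : Fin 1 → 𝔼 2) : Λ₂ w v = angleForm w (v 0) := by
  rw [Λ₂, toMForm_apply]
  simp

/-- `w ↦ angleForm w` is `C^∞` (linear in `w`). [folklore] -/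
theorem contDiff_angleForm : ContDiff ℝ ∞ (angleForm : 𝔼 2 → (𝔼 2) →L[ℝ] ℝ) := by
  unfold angleForm
  fun_prop

/-- `Λ₂` is a smooth form. [folklore] -/
theorem isSmoothForm_Λ₂ : IsSmoothForm Λ₂ :=
  (isSmoothForm_toMForm_iff _).2 (contDiff_ofSubsingleton_comp contDiff_angleForm)

/-- **The projection `πw (ψ, x, y) = (x, y)`** from `ℝ³` to the plane of the meridional disc.
[folklore] -/
def πw : (𝔼 3) →L[ℝ] (𝔼 2) :=
  LinearMap.toContinuousLinearMap
    { toFun := fun p => WithLp.toLp 2 ![p 1, p 2]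
      map_add' := fun p q => by
        ext i; fin_cases i <;> simp
      map_smul' := fun c p => by
        ext i; fin_cases i <;> simp }

/-- First coordinate of `πw p` is `x = p 1`. [folklore] -/
@[simp] theorem πw_apply_zero (p : 𝔼 3) : πw p 0 = p 1 := rfl

/-- Second coordinate of `πw p` is `y = p 2`. [folklore] -/
@[simp] theorem πw_apply_one (p : 𝔼 3) : πw p 1 = p 2 := rfl

/-- `‖πw p‖² = rho p`. [folklore] -/
theorem norm_πw_sq (p : 𝔼 3) : ‖πw p‖ ^ 2 = rho p := by
  rw [EuclideanSpace.norm_eq, Real.sq_sqrt (Finset.sum_nonneg fun i _ => by positivity),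
    Fin.sum_univ_two]
  simp [rho]

/-- `πw p = 0` iff `rho p = 0`. [folklore] -/
theorem πw_eq_zero_iff (p : 𝔼 3) : πw p = 0 ↔ rho p = 0 := by
  rw [← norm_eq_zero, ← sq_eq_zero_iff, norm_πw_sq]

/-- `πw` is `C^∞`. [folklore] -/
theorem contDiff_πw : ContDiff ℝ ∞ (πw : 𝔼 3 → 𝔼 2) := πw.contDiff

/-- The angle form of the plane, pulled back by `πw`, is `lam`:
`dφ_{πw p}(πw v) = x v_y - y v_x`. [folklore] -/
theorem angleForm_πw (p v : 𝔼 3) : angleForm (πw p) (πw v) = lam p ![v] := by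
  simp [angleForm_apply]

end Model

end Literature.Geometry.Symplectic

end
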